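import Summits.QuantumFields.BalabanUV.Beta.D1BFx.ChartDefectRowDdUniform

/-!
# `BalabanUV.Beta.D1BFx.ChartDefectRowDdScales` — road «BF-x», binder row D1, PART 24-hyb HEAD ON THE SCALES (OWNER d1-p2 g25 `ChartDefectHeadScales` v1 p372246:
# «constants `C•` FIXED BEFORE `∀ m`»): **ROW (dd) ON THE SCALES, ONE m-INDEPENDENT CONSTANT, HYPOTHESIS-FREE** — at every scale `n := Lc^m` the HEAD's pinned (dd) kernel
# `z₀ ↦ ½·tadpole G₀ ([Λc e z₀, [Λc a 0, Dsh (Lc^m)]])` (`G₀ = coDressKBmAt (ctr 4 (Lc^m)) (Lc^m) (KInvStep 3 (Lc^m) 0)`, `Λc μ y = diagK ((Lc^m)⁴∕2 · bmGaugeAt ρ_c (colH K₀ (Lc^m) μ y) (Lc^m) ∘ legSite ρ_c)`)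
# has absolutely summable (1.22) second moments and `|secondMoment (W_dd m) μ ν| ≤ C_dd` with
# `C_dd = (32·(C_int′ + 4·C_G′)·(Cλe^{κ′∕2})²·(e^{2κ′}+1)²·Zl 4 (κ′∕8))·Σ'_x |x|₁² e^{−(κ′∕8)|x|₁}` — NO `m`, NO `Lc`, NO hypothesis: ONE APPLICATION PER SCALE of this lineage's
# `ChartDefectRowDdUniform.row_dd_road_uniform` (FILE 6 of the O-9∕O-10 chain) at `n := Lc^m`.

HONEST DEPENDENCY (cell records, verbatim): «continuum YM on T⁴ ⇐ BetaPertH ∧ nine spine estimates (0/9 proved); BetaPertH ⇐ (D1) ∧ (D4) ∧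
CAP+tail; G-an2-4 gates asym, D1 and NE2/3/4.»  HONEST FRAMING (cell contract, verbatim): «discharging `BetaPertH` makes Bałaban's UV stability
UNCONDITIONAL — a real constructive-QFT result; it is NOT the continuum limit and NOT the Clay problem.»  THIS MODULE is [folklore] binder-order bookkeeping BY NAME
over ONE landed-chain theorem of this lineage (`row_dd_road_uniform`, itself [our objects + folklore]: interior dressed columns `n⁻⁵` (`DressedColumnRibbon`) × the `Dsh` block
mass `n⁵` (`DshBlockMass`), face columns `n⁻⁴` (`PackedColumnEnvelope`) × the `Dsh` face mass `n⁴` (`DshFaceMass`), locked weights O(1), sign symmetry `BubbleParity`).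
No `def`, no `def … : Prop`, nothing cited, NO printed hypothesis, 0 sorry, default heartbeats.  WHAT IT IS: ONE of the EIGHT displayed rows of `ChartDefectHeadScales`
(`hWdd` by `rfl`, `hAdd ∕ hBdd` by §1) with its constant bound before `m` — the first of an2 R-D1-g48 W-6 (3)'s two uniformities for THIS row; the torus size does not occur
(the moment is the `ℤ⁴` sum).  WHAT IT IS NOT: the HEAD (seven rows remain: (ins) the OWNER's; (rest) gan24-leaf-05's; (mcol)(ms)(lamf) leaf-03's TT33–TT35 modulo `S₀`∕`hΦ`∕`cΛmax`;
(xb)(bb) read the leg's ff and mm blocks — located `n²·CΓ·CΦ` in sup·mass, an2 W-6 (3) re-pairing candidates, NOT priced); NOT a binder; 0∕4 row-D1 binders (hW ∕ hR ∕ D1Tel ∕ D1Rep);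
(K) NOT closed; (J1) ONE OPEN ROW; NOT D1, NEVER «G-an2-4 closed», NOT `BetaPertH`, NOT continuum, NOT Clay.

ABSOLUTE RULE (cell charter, verbatim): «No internally-minted statement may enter as a cited fact. Every hypothesis is either kernel-proved in
this package or a verbatim quotation of a PUBLISHED theorem with page reference. The manuscript(s) under audit are NOT citable for their own
disputed steps — they are the thing under adjudication; programme-internal (2001/route/tribunal) claims are never citable.»

CONTENT.  §1 **`row_dd_scales`** (`Lc ≠ 0`; `μ ν : Fin 4`): `(∀ m a e, AbsMoment₂ (W_dd m a e)) ∧ ∀ m, |secondMoment (W_dd m) μ ν| ≤ C_dd`, `W_dd m` THE LITERAL of `ChartDefectHeadScales`'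
pin `hWdd` at scale `m` (so the consumer takes `Wdd := fun m a e z₀ ↦ (the literal)`, `hWdd := fun _ _ _ _ ↦ rfl`, `hAdd := (row_dd_scales μ ν).1`, `hBdd := (row_dd_scales μ ν).2`,
`Cdd := C_dd`); **`decay510_row_dd_scales`** (the same row in the `Decay510` door's currency, rate `κ′∕8`, constant `32·(C_int′ + 4·C_G′)·(…)·Zl 4 (κ′∕8)`, every scale).
`C_int′ = 8·MD163 4·periodConst (κ₁₆₃ 4) 3·e^{κ₁₆₃(4)∕4}`, `C_G′ = C₄·(1 + 8(1 + e^{κ₁₆₃(4)∕4}))·e^{κ₁₆₃(4)∕4}`, `C₄ = MG163 4·periodConst (κ₁₆₃ 4) 3`, `Cλ = 4C₄e^{κ′}`, `κ′ = κ₁₆₃(3+1)∕((3:ℝ)+1)`.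
Unit `b2b-balaban-beta-d1-formalise-leaf-01` (gen 34), D1 formalisation swarm LEAF PROVER 01, road «BF-x»; OFFER O-11 (files after FILE 6 `ChartDefectRowDdUniform` ✓).
Not in print; our bookkeeping.  No existing file touched.
-/

noncomputable section

namespace Summit.QuantumFields.BalabanUV.Beta.D1BFx.ChartDefectRowDdScales

open Literature.MathematicalPhysics.QuantumFieldTheory
open Literature.MathematicalPhysics.QuantumFieldTheory.Balaban1983to89
open Literature.MathematicalPhysics.QuantumFieldTheory.Balaban1983to89.Beta
open B12Sec2to5 (l1 Decay510)
open B12Beta (secondMoment)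
open DecimatedMomentSummable (AbsMoment₂)
open ExpKernelCalculus (Zl comp tadpole)
open OneStepKernelFamily (colH KInvStep)
open AffineAveraging (Site)
open AveragingContoursRooted (ctr)
open Summit.QuantumFields.BalabanUV.Beta.BorderedHessian (diagK)
open Summit.QuantumFields.BalabanUV.Beta.AxialDressingRooted (coDressKBmAt)
open Summit.QuantumFields.BalabanUV.Beta.DshAn1 (Dsh)
open Summit.QuantumFields.BalabanUV.Beta.AxialProjectorBlockMean (bmGaugeAt)
open Summit.QuantumFields.BalabanUV.Beta.AveragingWardRootedStencils (legSite)
open Summit.QuantumFields.BalabanUV.Beta.D1BFx.ChartDefectRowDdUniform (decay510_row_dd_road_uniform row_dd_road_uniform)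
open B5Hk163Strip (kappa163)
open B5Hk163Decay (MG163)
open B5Hk163TorusHolderDecay (MD163)
open B4TorusKernel (periodConst)

variable {Lc : ℕ} [NeZero Lc]

/-! ## §1 Row (dd) of the HEAD on the scales `n := Lc^m`: one application of FILE 6 per scale -/

/-- **ROW (dd) ON THE SCALES IN THE `Decay510` CURRENCY** [our objects + folklore]: for every scale `m` and all `a e : Fin 4`,
`Decay510 (z₀ ↦ ½·tadpole G₀ ([Λc e z₀, [Λc a 0, Dsh (Lc^m)]])) (32·(C_int′ + 4·C_G′)·(Cλe^{κ′∕2})²·(e^{2κ′}+1)²·Zl 4 (κ′∕8)) (κ′∕8)` at `n := Lc^m` — constant and rate free of `m`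
(`ChartDefectRowDdUniform.decay510_row_dd_road_uniform` at `n := Lc^m`; `NeZero (Lc^m)` from `NeZero Lc`). -/
theorem decay510_row_dd_scales (m : ℕ) (a e : Fin 4) :
    Decay510 (fun z₀ : Site 4 => (1 / 2 : ℝ) * tadpole (coDressKBmAt (ctr 4 (Lc ^ m)) (Lc ^ m) (KInvStep (d := 3) (Lc ^ m) 0))
        (comp (diagK fun z' b => ((Lc ^ m : ℕ) : ℝ) ^ 4 / 2 * bmGaugeAt (ctr 4 (Lc ^ m)) (colH (KInvStep (d := 3) (Lc ^ m) 0) (Lc ^ m) e z₀) (Lc ^ m) (legSite (ctr 4 (Lc ^ m)) z' b))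
            (comp (diagK fun z' b => ((Lc ^ m : ℕ) : ℝ) ^ 4 / 2 * bmGaugeAt (ctr 4 (Lc ^ m)) (colH (KInvStep (d := 3) (Lc ^ m) 0) (Lc ^ m) a 0) (Lc ^ m) (legSite (ctr 4 (Lc ^ m)) z' b)) (Dsh (Lc ^ m))
              - comp (Dsh (Lc ^ m)) (diagK fun z' b => ((Lc ^ m : ℕ) : ℝ) ^ 4 / 2 * bmGaugeAt (ctr 4 (Lc ^ m)) (colH (KInvStep (d := 3) (Lc ^ m) 0) (Lc ^ m) a 0) (Lc ^ m) (legSite (ctr 4 (Lc ^ m)) z' b)))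
          - comp (comp (diagK fun z' b => ((Lc ^ m : ℕ) : ℝ) ^ 4 / 2 * bmGaugeAt (ctr 4 (Lc ^ m)) (colH (KInvStep (d := 3) (Lc ^ m) 0) (Lc ^ m) a 0) (Lc ^ m) (legSite (ctr 4 (Lc ^ m)) z' b)) (Dsh (Lc ^ m))
              - comp (Dsh (Lc ^ m)) (diagK fun z' b => ((Lc ^ m : ℕ) : ℝ) ^ 4 / 2 * bmGaugeAt (ctr 4 (Lc ^ m)) (colH (KInvStep (d := 3) (Lc ^ m) 0) (Lc ^ m) a 0) (Lc ^ m) (legSite (ctr 4 (Lc ^ m)) z' b)))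
            (diagK fun z' b => ((Lc ^ m : ℕ) : ℝ) ^ 4 / 2 * bmGaugeAt (ctr 4 (Lc ^ m)) (colH (KInvStep (d := 3) (Lc ^ m) 0) (Lc ^ m) e z₀) (Lc ^ m) (legSite (ctr 4 (Lc ^ m)) z' b))))
      (32 * ((8 * (MD163 4 * periodConst (kappa163 4) 3) * Real.exp (kappa163 4 / 4)) + 4 * ((MG163 4 * periodConst (kappa163 4) 3) * (1 + 8 * (1 + Real.exp (kappa163 4 / 4))) * Real.exp (kappa163 4 / 4)))
        * ((((4 * (MG163 (3 + 1) * periodConst (kappa163 (3 + 1)) 3) * Real.exp (kappa163 (3 + 1) / ((3 : ℝ) + 1))) * Real.exp (kappa163 (3 + 1) / ((3 : ℝ) + 1) / 2)) * ((4 * (MG163 (3 + 1) * periodConst (kappa163 (3 + 1)) 3) * Real.exp (kappa163 (3 + 1) / ((3 : ℝ) + 1))) * Real.exp (kappa163 (3 + 1) / ((3 : ℝ) + 1) / 2)) * (Real.exp (2 * (kappa163 (3 + 1) / ((3 : ℝ) + 1))) + 1) ^ 2) * Zl 4 (kappa163 (3 + 1) / ((3 : ℝ) + 1) / 8)))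
      (kappa163 (3 + 1) / ((3 : ℝ) + 1) / 8) :=
  decay510_row_dd_road_uniform (n := Lc ^ m) a e

/-- **ROW (dd) ON THE SCALES — THE `ChartDefectHeadScales` BINDERS `hAdd` ∧ `hBdd` WITH `Cdd` BOUND BEFORE `m`, HYPOTHESIS-FREE** [our objects + folklore]:
(i) `∀ m a e, AbsMoment₂ (z₀ ↦ ½·tadpole G₀ ([Λc e z₀, [Λc a 0, Dsh (Lc^m)]]))` at `n := Lc^m`;
(ii) `∀ m, |secondMoment (a e z₀ ↦ …) μ ν| ≤ (32·(C_int′ + 4·C_G′)·(Cλe^{κ′∕2})²·(e^{2κ′}+1)²·Zl 4 (κ′∕8))·Σ'_x |x|₁² e^{−(κ′∕8)|x|₁}` — the right-hand side mentions neither `m` nor `Lc`.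
The kernel is `ChartDefectHeadScales.abs_secondMoment_chartDefect_scales_le_of_rows`' pin `hWdd` VERBATIM (take `Wdd := fun m a e z₀ ↦` this literal, `hWdd := fun _ _ _ _ ↦ rfl`,
`hAdd := (row_dd_scales μ ν).1`, `hBdd := (row_dd_scales μ ν).2`).  One of eight rows; NOT the HEAD, NOT a binder. -/
theorem row_dd_scales (μ ν : Fin 4) :
    (∀ (m : ℕ) (a e : Fin 4), AbsMoment₂ (fun z₀ : Site 4 => (1 / 2 : ℝ) * tadpole (coDressKBmAt (ctr 4 (Lc ^ m)) (Lc ^ m) (KInvStep (d := 3) (Lc ^ m) 0))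
        (comp (diagK fun z' b => ((Lc ^ m : ℕ) : ℝ) ^ 4 / 2 * bmGaugeAt (ctr 4 (Lc ^ m)) (colH (KInvStep (d := 3) (Lc ^ m) 0) (Lc ^ m) e z₀) (Lc ^ m) (legSite (ctr 4 (Lc ^ m)) z' b))
            (comp (diagK fun z' b => ((Lc ^ m : ℕ) : ℝ) ^ 4 / 2 * bmGaugeAt (ctr 4 (Lc ^ m)) (colH (KInvStep (d := 3) (Lc ^ m) 0) (Lc ^ m) a 0) (Lc ^ m) (legSite (ctr 4 (Lc ^ m)) z' b)) (Dsh (Lc ^ m))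
              - comp (Dsh (Lc ^ m)) (diagK fun z' b => ((Lc ^ m : ℕ) : ℝ) ^ 4 / 2 * bmGaugeAt (ctr 4 (Lc ^ m)) (colH (KInvStep (d := 3) (Lc ^ m) 0) (Lc ^ m) a 0) (Lc ^ m) (legSite (ctr 4 (Lc ^ m)) z' b)))
          - comp (comp (diagK fun z' b => ((Lc ^ m : ℕ) : ℝ) ^ 4 / 2 * bmGaugeAt (ctr 4 (Lc ^ m)) (colH (KInvStep (d := 3) (Lc ^ m) 0) (Lc ^ m) a 0) (Lc ^ m) (legSite (ctr 4 (Lc ^ m)) z' b)) (Dsh (Lc ^ m))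
              - comp (Dsh (Lc ^ m)) (diagK fun z' b => ((Lc ^ m : ℕ) : ℝ) ^ 4 / 2 * bmGaugeAt (ctr 4 (Lc ^ m)) (colH (KInvStep (d := 3) (Lc ^ m) 0) (Lc ^ m) a 0) (Lc ^ m) (legSite (ctr 4 (Lc ^ m)) z' b)))
            (diagK fun z' b => ((Lc ^ m : ℕ) : ℝ) ^ 4 / 2 * bmGaugeAt (ctr 4 (Lc ^ m)) (colH (KInvStep (d := 3) (Lc ^ m) 0) (Lc ^ m) e z₀) (Lc ^ m) (legSite (ctr 4 (Lc ^ m)) z' b))))) ∧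
      ∀ m : ℕ, |secondMoment (fun (a e : Fin 4) (z₀ : Site 4) => (1 / 2 : ℝ) * tadpole (coDressKBmAt (ctr 4 (Lc ^ m)) (Lc ^ m) (KInvStep (d := 3) (Lc ^ m) 0))
        (comp (diagK fun z' b => ((Lc ^ m : ℕ) : ℝ) ^ 4 / 2 * bmGaugeAt (ctr 4 (Lc ^ m)) (colH (KInvStep (d := 3) (Lc ^ m) 0) (Lc ^ m) e z₀) (Lc ^ m) (legSite (ctr 4 (Lc ^ m)) z' b))
            (comp (diagK fun z' b => ((Lc ^ m : ℕ) : ℝ) ^ 4 / 2 * bmGaugeAt (ctr 4 (Lc ^ m)) (colH (KInvStep (d := 3) (Lc ^ m) 0) (Lc ^ m) a 0) (Lc ^ m) (legSite (ctr 4 (Lc ^ m)) z' b)) (Dsh (Lc ^ m))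
              - comp (Dsh (Lc ^ m)) (diagK fun z' b => ((Lc ^ m : ℕ) : ℝ) ^ 4 / 2 * bmGaugeAt (ctr 4 (Lc ^ m)) (colH (KInvStep (d := 3) (Lc ^ m) 0) (Lc ^ m) a 0) (Lc ^ m) (legSite (ctr 4 (Lc ^ m)) z' b)))
          - comp (comp (diagK fun z' b => ((Lc ^ m : ℕ) : ℝ) ^ 4 / 2 * bmGaugeAt (ctr 4 (Lc ^ m)) (colH (KInvStep (d := 3) (Lc ^ m) 0) (Lc ^ m) a 0) (Lc ^ m) (legSite (ctr 4 (Lc ^ m)) z' b)) (Dsh (Lc ^ m))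
              - comp (Dsh (Lc ^ m)) (diagK fun z' b => ((Lc ^ m : ℕ) : ℝ) ^ 4 / 2 * bmGaugeAt (ctr 4 (Lc ^ m)) (colH (KInvStep (d := 3) (Lc ^ m) 0) (Lc ^ m) a 0) (Lc ^ m) (legSite (ctr 4 (Lc ^ m)) z' b)))
            (diagK fun z' b => ((Lc ^ m : ℕ) : ℝ) ^ 4 / 2 * bmGaugeAt (ctr 4 (Lc ^ m)) (colH (KInvStep (d := 3) (Lc ^ m) 0) (Lc ^ m) e z₀) (Lc ^ m) (legSite (ctr 4 (Lc ^ m)) z' b)))) μ ν|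
        ≤ (32 * ((8 * (MD163 4 * periodConst (kappa163 4) 3) * Real.exp (kappa163 4 / 4)) + 4 * ((MG163 4 * periodConst (kappa163 4) 3) * (1 + 8 * (1 + Real.exp (kappa163 4 / 4))) * Real.exp (kappa163 4 / 4)))
        * ((((4 * (MG163 (3 + 1) * periodConst (kappa163 (3 + 1)) 3) * Real.exp (kappa163 (3 + 1) / ((3 : ℝ) + 1))) * Real.exp (kappa163 (3 + 1) / ((3 : ℝ) + 1) / 2)) * ((4 * (MG163 (3 + 1) * periodConst (kappa163 (3 + 1)) 3) * Real.exp (kappa163 (3 + 1) / ((3 : ℝ) + 1))) * Real.exp (kappa163 (3 + 1) / ((3 : ℝ) + 1) / 2)) * (Real.exp (2 * (kappa163 (3 + 1) / ((3 : ℝ) + 1))) + 1) ^ 2) * Zl 4 (kappa163 (3 + 1) / ((3 : ℝ) + 1) / 8)))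
          * ∑' x : Site 4, l1 x ^ 2 * Real.exp (-(kappa163 (3 + 1) / ((3 : ℝ) + 1) / 8) * l1 x) :=
  ⟨fun m a e => (row_dd_road_uniform (n := Lc ^ m) μ ν).1 a e, fun m => (row_dd_road_uniform (n := Lc ^ m) μ ν).2⟩

end Summit.QuantumFields.BalabanUV.Beta.D1BFx.ChartDefectRowDdScales

end
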